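import Summits.QuantumFields.BalabanUV.T4Continuum.Spine.NE4.KingCurrencyPointwise
import Summits.QuantumFields.BalabanUV.T4Continuum.Support.NE7PairwiseCouplingDock

/-!
# Spine/NE4/KingCurrencyPairCauchyDock — the Arzelà–Ascoli upgrade of `KingCurrencyPointwise` DOCKED BY NAME into the PRIOR-ART
# pairwise route «PAIR-CAUCHY» (`Support/NE7PairwiseCouplingDock.couplingGap_tendsto_zero`, pub-balaban NE7 #2 lineage, 2026-08-21∕22)

Cell `pub-balaban-gaps` (YM blitz G2), seat `ne4` generation 13 (unit `pub-balaban-gaps-ne4-g13`), record `HOME/ne/NE4.md` §5 (R51) + §21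
erratum.  CREDIT: the route «PAIR-CAUCHY» (`Support/NE7PairwiseScaleShift` ∕ `…CouplingStep` ∕ `…MarginalBox` ∕ `…CouplingDock` ∕ `…CouplingUniform` ∕
`…OffsetEnd`) runs node U2 on the cutoff pair `(K, K+n)` and consumes, as ITS ask in the marginal channel, the NULL n-layer scale-shift
modulus (σ) — `∀ n k w ∈ box, |β (k+n) (prefixOf w (k+n)) − β k (prefixOf (w ∘ (·+n)) k)| ≤ σ k`, `σ → 0` — which is `KingCurrency.UniformShift`
verbatim.  `KingCurrencyPointwise.exists_uniformShift_of_pointwise` DERIVES (σ) from the weakest β-side statement: POINTWISE Cauchy-ness of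
`k ↦ β k (revHist h k)` along every box-valued history + the memory companion (`HistLipschitz` ∕ `FadingMemory`) + the printed-type bound.
THIS FILE (one theorem, no estimate): `couplingGap_tendsto_zero_of_pointwise` — PAIR-CAUCHY's dock conclusion
`∀ m, |1∕(g K (K−m))² − 1∕(g (K + n K) (K−m + n K))²| → 0` under (P) + the dock's own other binders, (σ) being supplied by the upgrade.

HONEST FRAMING.  Composition BY NAME of two kernel theorems on hypothesis SHAPES (0 sorry, standard axioms); nothing of Bałaban's asserted;
(P) ∕ NE4 NOT IN PRINT; spine PROVED 0∕9; rung (B)+1 on ONE finite T⁴ — NOT ℝ⁴, NOT infinite volume, NOT a mass gap, NOT Clay.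
-/

noncomputable section

namespace Summit.QuantumFields.BalabanUV.T4Continuum.Spine.NE4.KingCurrencyPairCauchyDock

open Filter Topology
open Literature.MathematicalPhysics.QuantumFieldTheory.Balaban1983to89
open Literature.MathematicalPhysics.QuantumFieldTheory.Balaban1983to89.FlowStep
open Literature.MathematicalPhysics.QuantumFieldTheory.Balaban1983to89.T4CouplingMatching
open Literature.MathematicalPhysics.QuantumFieldTheory.Balaban1983to89.T4BetaStationary
open Summit.QuantumFields.BalabanUV.T4Continuum.Spine.NE4.KingCurrencyPointwise (exists_uniformShift_of_pointwise)
open Summit.QuantumFields.BalabanUV.T4Continuum.NE7PairwiseCouplingDock (couplingGap_tendsto_zero)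

/-- **PAIR-CAUCHY's MARGINAL DOCK FROM POINTWISE CONVERGENCE.**  The hypotheses of `NE7PairwiseCouplingDock.couplingGap_tendsto_zero` with
its null modulus (σ) REPLACED by: (P) `k ↦ β k (revHist h k)` is Cauchy for every box-valued reversed history `h` (Bałaban's β-function has a
limit as the cutoff is removed, history by history — NO rate, NO uniformity) and the printed-type bound `|β| ≤ B` on the boxes (the memory
companion `HistLipschitz Λ` ∕ `FadingMemory C θ Λ`, the AF binders `EventualLowerH` ∕ `BetaUpperH`, the pinned runs and the window
`C·((k₀+1)γ³ + 2γ∕b)∕(1−θ) ≤ q < 1` are the dock's own).  Conclusion = the dock's: for every depth `m` and every gap sequence `n K`,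
`|1∕(g K (K−m))² − 1∕(g (K + n K) (K − m + n K))²| → 0`.  (σ) is produced by `exists_uniformShift_of_pointwise` (Arzelà–Ascoli). [folklore] -/
theorem couplingGap_tendsto_zero_of_pointwise {β : HBeta} {γ b β' C θ q gIR B : ℝ} {k₀ : ℕ} {Λ : ℕ → ℕ → ℝ}
    (g : ℕ → ℕ → ℝ) (n : ℕ → ℕ)
    (hγ : 0 < γ) (hb : 0 < b) (hθ0 : 0 < θ) (hθ1 : θ < 1) (hβ' : 0 ≤ β')
    (hrun : ∀ N, RGEqH N β (g N)) (hbox : ∀ N i, i ≤ N → 0 < g N i ∧ g N i ≤ γ)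
    (hpin : ∀ N, g N N = gIR)
    (hL : HistLipschitz Λ γ β) (hΛ : FadingMemory C θ Λ)
    (hlo : EventualLowerH b γ k₀ β) (hup : BetaUpperH β' γ β)
    (hbd : ∀ k (v : Fin (k + 1) → ℝ), v ∈ Box γ k → |β k v| ≤ B)
    (hpt : ∀ h : ℕ → ℝ, SeqBox γ h → CauchySeq fun k => β k (revHist h k))
    (hq : C * ((((k₀ : ℝ) + 1) * γ ^ 3 + 2 * γ / b) / (1 - θ)) ≤ q) (hq1 : q < 1) :
    ∀ m, Tendsto (fun K => |1 / (g K (K - m)) ^ 2 - 1 / (g (K + n K) (K - m + n K)) ^ 2|) atTop (𝓝 0) := by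
  have hC : 0 ≤ C := constant_nonneg_of_fadingMemory hΛ
  obtain ⟨σ, _, hσ0, hσ⟩ := exists_uniformShift_of_pointwise hγ hθ0.le hθ1 hL hΛ hbd hpt
  exact couplingGap_tendsto_zero g n hγ hb hθ0.le hθ1 hC hβ' hrun hbox hpin hL hΛ hlo hup
    (fun n k w hw => hσ n k w hw) hσ0 hq hq1

end Summit.QuantumFields.BalabanUV.T4Continuum.Spine.NE4.KingCurrencyPairCauchyDock
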